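import Literature.AlgebraicGeometry.Morphisms.RationalPointsCoproduct
import Literature.AlgebraicGeometry.GroupActions.FixedPointSchemeSmoothHolds
import Literature.AlgebraicGeometry.Motives.VarietiesGeometricallyIntegralProofs
import HarnessLib

/-!
# A fixed-point scheme with finitely many rational points is the disjoint union of that many
# reduced points (Conrad–Gabber–Prasad A.8.10 over an algebraically closed field)

Literature topic `AlgebraicGeometry/GroupActions`.  PROOF FILE (theorems only; no definition, no
named fact, nothing posited).  Companion of `FixedPointScheme.lean` (the interface
`IsFixedPointScheme`, Conrad–Gabber–Prasad A.8.10(1)), `FixedPointSchemeSmoothOverBase.lean` /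
`FixedPointSchemeSmoothHolds.lean` (A.8.10(2) = Edixhoven 1992 Prop. 3.4, PROVED:
`Edixhoven1992_fixedPointScheme_smooth_holds`) and `Morphisms/RationalPointsCoproduct.lean`
(a reduced `k`-scheme locally of finite type over an algebraically closed `k` with finitely many
`k`-points is their coproduct; Görtz–Wedhorn I Cor. 3.36 / Prop. 5.20).

Let `k` be an algebraically closed field, `G` a finite group whose order is invertible in `k`
(automatic in characteristic `0`), `Y` a SMOOTH `k`-scheme with a `G`-action by `k`-automorphisms
`ρ : G →* Aut Y`, and `j : F ⟶ Y` a fixed-point scheme of `ρ` (`IsFixedPointScheme ρ j`).  Then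

* `IsFixedPointScheme.smooth_of_isUnit`, `….isReduced_of_isUnit` — `F` is smooth over `k`
  (Conrad–Gabber–Prasad, *Pseudo-reductive groups*, Prop. A.8.10(2) «if `Y` is smooth then `Y^G`
  is smooth» [corpus: book:conrad2010-pseudo-reductive-groups p0649], in the tree
  `smooth_of_isFixedPointScheme_of_isUnit` fed with the PROVED `Edixhoven1992_fixedPointScheme_smooth_holds`),
  hence reduced (Stacks 056T, tree `Motives.isReduced_of_smooth_over_field`);
* `IsFixedPointScheme.natCard_points_eq` — the `k`-points `𝟙_ ⟶ F` of `F` are the `ρ`-invariant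
  `k`-points of `Y` (A.8.10(1), functor of points);
* `IsFixedPointScheme.exists_fin_isColimit_cofan_of_natCard_eq` (`…_fixedPoints_eq`) — **if `F`
  has (equivalently: `Y` has exactly) `N` (`ρ`-invariant) `k`-points, `N ≠ 0` or the set finite,
  then `F ≅ ∐_N Spec k`**: there is an injective `x : Fin N → (𝟙_ ⟶ F)` with `Cofan.mk F x` a
  colimit in `Over (Spec k)` — "the fixed-point scheme consists of `N` reduced points";
* `exists_fin_isColimit_cofan_of_natCard_fixedBy_eq`, `…_of_isOfFinOrder` — the CYCLIC case
  `G = ⟨g⟩ ≤ Aut Y`, `g` of finite order (invertible in `k`; any finite order in characteristic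
  `0`): if exactly `N ≠ 0` `k`-points of `Y` satisfy `y ≫ g = y`, EVERY fixed-point scheme
  `j : F ⟶ Y` of `⟨g⟩` is the coproduct of `N` copies of `𝟙_ = Spec k`.

CONSUMER (cell `hodge-kum4`, ladder HodgeAV rung H3, tranche LT-H3 of the literature-typing layer):
the last clause is, for `k = ℂ`, `Y = X` smooth projective of `Kum⁴`-type, `g = δ ∈ Γ(X) ∖ 1`
(`δ⁵ = 1`) and `N = 125`, EXACTLY the inner conclusion
`∀ ⦃F⦄ (j : F ⟶ X), IsFixedPointScheme (Subgroup.zpowers δ.val).subtype j →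
 ∃ x : Fin 125 → (𝟙_ ⟶ F), Nonempty (IsColimit (Cofan.mk F x))` of the PRINT-SYNTHESIS fact
`Hyperkaehler.HassettTschinkel2013_Oguiso2020_fixedPointScheme_translation_kum4Type` (F125X) and of
`Oguiso2020_fixedPointScheme_translation_generalizedKummerFour`, reduced to the single COUNT
`Nat.card {y : 𝟙_ ⟶ X // y ≫ δ = y} = 125` — the scheme-theoretic end («(iv) REDUCEDNESS … it is
`⊔₁₂₅ Spec ℂ`») of the kernel derivation of F125X is thereby a theorem of the tree; the count itself
is the analytic fixed-point transport (`Geometry/Hyperkaehler/AutomorphismsLocalSystemFixedPoints*`,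
`Geometry/Kaehler/FixedLocus*`) plus GAGA, not done here.  Nothing in this file concerns the Hodge
conjecture.  Mathlib/tree searched: `IsFixedPointObject.homEquiv`, `smooth_of_isFixedPointScheme_of_isUnit`,
`Edixhoven1992_fixedPointScheme_smooth_holds`, `Motives.isReduced_of_smooth_over_field`,
`Morphisms.exists_fin_isColimit_cofan_of_natCard_eq`, `Nat.card_zpowers` (used).

## References
* [ConradGabberPrasad2015] B. Conrad, O. Gabber, G. Prasad, *Pseudo-reductive groups* (2nd ed.,
  CUP 2015), Prop. A.8.10 (1) fixed-point scheme represents the invariants and is closed, (2) smooth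
  when `Y` is smooth and `|G|` is invertible.
* [Edixhoven1992NeronModelsTame] B. Edixhoven, *Néron models and tame ramification*, Compositio
  Math. 81 (1992), Prop. 3.4.
* [GortzWedhorn2020] U. Görtz, T. Wedhorn, *Algebraic Geometry I* (2nd ed., 2020), Cor. 3.36,
  Prop. 5.20.
* [StacksProject] Tag 056T (smooth over a field ⇒ geometrically reduced).
-/

set_option autoImplicit false

noncomputable section

open CategoryTheory CategoryTheory.Limits AlgebraicGeometry MonoidalCategory

namespace Literature.AlgebraicGeometry.GroupActions

universe u v

variable {K : Type u} [Field K] {G : Type v} [Group G] [Finite G]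
variable {Y F : Over (Spec (CommRingCat.of K))} {ρ : G →* Aut Y} {j : F ⟶ Y}

/-! ## Smooth, hence reduced (Conrad–Gabber–Prasad A.8.10(2), proved in the tree) -/

/-- **The fixed-point scheme of a finite group of invertible order acting on a smooth `k`-scheme is
smooth over `k`** — Conrad–Gabber–Prasad A.8.10(2) / Edixhoven 1992 Prop. 3.4, UNCONDITIONALLY (the
named fact `Edixhoven1992_fixedPointScheme_smooth` is proved in the tree, `…_holds`).
[cite: ConradGabberPrasad2015, Prop. A.8.10(2)] [cite: Edixhoven1992NeronModelsTame, §3 Prop. 3.4] -/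
theorem IsFixedPointScheme.smooth_of_isUnit (hF : IsFixedPointScheme ρ j) [Smooth Y.hom]
    (hG : IsUnit ((Nat.card G : ℕ) : K)) : Smooth F.hom :=
  smooth_of_isFixedPointScheme_of_isUnit Edixhoven1992_fixedPointScheme_smooth_holds hG hF

/-- … hence the fixed-point scheme is REDUCED (a scheme smooth over a field is reduced, Stacks 056T).
[cite: ConradGabberPrasad2015, Prop. A.8.10(2)] [cite: StacksProject, Tag 056T] -/
theorem IsFixedPointScheme.isReduced_of_isUnit (hF : IsFixedPointScheme ρ j) [Smooth Y.hom]
    (hG : IsUnit ((Nat.card G : ℕ) : K)) : IsReduced F.left :=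
  haveI := hF.smooth_of_isUnit hG
  Motives.isReduced_of_smooth_over_field F.hom

/-- In characteristic `0` the order of a finite group is invertible. [cite: ConradGabberPrasad2015, Prop. A.8.10(2)] -/
theorem isUnit_natCard_of_charZero [CharZero K] : IsUnit ((Nat.card G : ℕ) : K) :=
  (Nat.cast_ne_zero.mpr (Nat.card_pos (α := G)).ne').isUnit

/-! ## The rational points of the fixed-point scheme are the invariant rational points -/

omit [Finite G] in
/-- **Functor of points of `Y^G` on `k`-points**: the `k`-points `𝟙_ ⟶ F` of a fixed-point scheme
`j : F ⟶ Y` of `ρ` are in bijection with the `ρ`-invariant `k`-points of `Y` (composition with `j`);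
in particular they have the same cardinality. [cite: ConradGabberPrasad2015, Prop. A.8.10(1)] -/
theorem IsFixedPointScheme.natCard_points_eq (hF : IsFixedPointScheme ρ j) :
    Nat.card (𝟙_ (Over (Spec (CommRingCat.of K))) ⟶ F) =
      Nat.card {y : 𝟙_ (Over (Spec (CommRingCat.of K))) ⟶ Y // ∀ g : G, y ≫ (ρ g).hom = y} :=
  Nat.card_congr (hF.toIsFixedPointObject.homEquiv _)

omit [Finite G] in
/-- … and one set is finite iff the other is. [cite: ConradGabberPrasad2015, Prop. A.8.10(1)] -/
theorem IsFixedPointScheme.finite_points_iff (hF : IsFixedPointScheme ρ j) :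
    Finite (𝟙_ (Over (Spec (CommRingCat.of K))) ⟶ F) ↔
      Finite {y : 𝟙_ (Over (Spec (CommRingCat.of K))) ⟶ Y // ∀ g : G, y ≫ (ρ g).hom = y} :=
  ⟨fun _ => Finite.of_equiv _ (hF.toIsFixedPointObject.homEquiv _),
    fun _ => Finite.of_equiv _ (hF.toIsFixedPointObject.homEquiv _).symm⟩

/-! ## Splitting: `F ≅ ∐_N Spec k` -/

variable [IsAlgClosed K]

/-- **A fixed-point scheme with finitely many rational points is the coproduct of that many reduced
points.**  `k` algebraically closed, `G` finite of order invertible in `k`, `Y` smooth over `k`,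
`j : F ⟶ Y` a fixed-point scheme of `ρ : G →* Aut Y` with finitely many `k`-points, `N` in number:
then there is an injective `x : Fin N → (𝟙_ ⟶ F)` (an enumeration of `F(k)`) with `Cofan.mk F x` a
colimit in `Over (Spec k)`, i.e. `F ≅ ∐_N Spec k`.  (A.8.10(2): `F` is smooth, hence reduced; a
reduced `k`-scheme locally of finite type with finitely many `k`-points is their coproduct,
`Morphisms.exists_fin_isColimit_cofan_of_natCard_eq`.)
[cite: ConradGabberPrasad2015, Prop. A.8.10(1)–(2)] [cite: GortzWedhorn2020, Cor. 3.36 and Prop. 5.20] -/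
theorem IsFixedPointScheme.exists_fin_isColimit_cofan_of_natCard_eq (hF : IsFixedPointScheme ρ j)
    [Smooth Y.hom] (hG : IsUnit ((Nat.card G : ℕ) : K))
    (hfin : Finite (𝟙_ (Over (Spec (CommRingCat.of K))) ⟶ F)) {N : ℕ}
    (hN : Nat.card (𝟙_ (Over (Spec (CommRingCat.of K))) ⟶ F) = N) :
    ∃ x : Fin N → (𝟙_ (Over (Spec (CommRingCat.of K))) ⟶ F),
      Function.Injective x ∧ Nonempty (IsColimit (Cofan.mk F x)) := by
  haveI : LocallyOfFiniteType F.hom := hF.locallyOfFiniteType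
  haveI : IsReduced F.left := hF.isReduced_of_isUnit hG
  exact Morphisms.exists_fin_isColimit_cofan_of_natCard_eq hfin hN

/-- **The same, counted on `Y`**: if exactly `N ≠ 0` rational points of the smooth `k`-scheme `Y`
are fixed by every `ρ g`, then every fixed-point scheme `j : F ⟶ Y` of `ρ` is the coproduct of `N`
copies of `Spec k` along an injective enumeration `x : Fin N → (𝟙_ ⟶ F)` of its `k`-points.
[cite: ConradGabberPrasad2015, Prop. A.8.10(1)–(2)] [cite: GortzWedhorn2020, Cor. 3.36 and Prop. 5.20] -/
theorem IsFixedPointScheme.exists_fin_isColimit_cofan_of_natCard_fixedPoints_eq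
    (hF : IsFixedPointScheme ρ j) [Smooth Y.hom] (hG : IsUnit ((Nat.card G : ℕ) : K)) {N : ℕ}
    (hN0 : N ≠ 0)
    (hN : Nat.card {y : 𝟙_ (Over (Spec (CommRingCat.of K))) ⟶ Y // ∀ g : G, y ≫ (ρ g).hom = y} = N) :
    ∃ x : Fin N → (𝟙_ (Over (Spec (CommRingCat.of K))) ⟶ F),
      Function.Injective x ∧ Nonempty (IsColimit (Cofan.mk F x)) := by
  rw [← hF.natCard_points_eq] at hN
  exact hF.exists_fin_isColimit_cofan_of_natCard_eq hG (Nat.finite_of_card_ne_zero (hN ▸ hN0)) hN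

/-! ## The cyclic case `G = ⟨g⟩` -/

omit [IsAlgClosed K] in
/-- A point fixed by `g` is fixed by every element of `⟨g⟩` (plumbing). [folklore] -/
private theorem comp_hom_eq_of_mem_zpowers {C : Type*} [Category C] {X T : C} (g : Aut X)
    (y : T ⟶ X) (hy : y ≫ g.hom = y) (a : Aut X) (ha : a ∈ Subgroup.zpowers g) :
    y ≫ a.hom = y := by
  -- the stabiliser of `y` is a subgroup containing `g`
  let H : Subgroup (Aut X) :=
    { carrier := {a | y ≫ a.hom = y}
      mul_mem' := fun {a b} ha hb => by
        change y ≫ (b.hom ≫ a.hom) = y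
        rw [← Category.assoc, hb, ha]
      one_mem' := Category.comp_id y
      inv_mem' := fun {a} ha => by
        change y ≫ a.inv = y
        conv_lhs => rw [← ha]
        rw [Category.assoc, Iso.hom_inv_id, Category.comp_id] }
  have hle : Subgroup.zpowers g ≤ H := (Subgroup.zpowers_le (G := Aut X)).mpr hy
  exact hle ha

omit [IsAlgClosed K] in
/-- The `⟨g⟩`-invariant points are the points fixed by `g`. [cite: ConradGabberPrasad2015, Prop. A.8.10(1)] -/
theorem natCard_fixedPoints_zpowers_eq {C : Type*} [Category C] {X : C} (T : C) (g : Aut X) :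
    Nat.card {y : T ⟶ X // ∀ a : Subgroup.zpowers g, y ≫ ((Subgroup.zpowers g).subtype a).hom = y} =
      Nat.card {y : T ⟶ X // y ≫ g.hom = y} := by
  refine Nat.card_congr (Equiv.subtypeEquivRight fun y => ⟨fun h => ?_, fun h a => ?_⟩)
  · exact h ⟨g, Subgroup.mem_zpowers g⟩
  · exact comp_hom_eq_of_mem_zpowers g y h a.val a.property

/-- **Cyclic case.**  `k` algebraically closed, `Y` smooth over `k`, `g ∈ Aut_k Y` with `|⟨g⟩|`
invertible in `k` (so `g` of finite order): if exactly `N ≠ 0` rational points `y` of `Y` satisfy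
`y ≫ g = y`, then EVERY fixed-point scheme `j : F ⟶ Y` of the cyclic group `⟨g⟩ ≤ Aut Y` is the
coproduct of `N` copies of `𝟙_ = Spec k`: `∃ x : Fin N → (𝟙_ ⟶ F)`, injective, with `Cofan.mk F x` a
colimit — "`Y^g` is `N` reduced points".
[cite: ConradGabberPrasad2015, Prop. A.8.10(1)–(2)] [cite: GortzWedhorn2020, Cor. 3.36 and Prop. 5.20] -/
theorem exists_fin_isColimit_cofan_of_natCard_fixedBy_eq [Smooth Y.hom] (g : Aut Y)
    (hg : IsUnit ((Nat.card (Subgroup.zpowers g) : ℕ) : K)) {N : ℕ} (hN0 : N ≠ 0)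
    (hN : Nat.card {y : 𝟙_ (Over (Spec (CommRingCat.of K))) ⟶ Y // y ≫ g.hom = y} = N)
    ⦃F : Over (Spec (CommRingCat.of K))⦄ (j : F ⟶ Y)
    (hF : IsFixedPointScheme (Subgroup.zpowers g).subtype j) :
    ∃ x : Fin N → (𝟙_ (Over (Spec (CommRingCat.of K))) ⟶ F),
      Function.Injective x ∧ Nonempty (IsColimit (Cofan.mk F x)) := by
  haveI : Finite (Subgroup.zpowers g) := Nat.finite_of_card_ne_zero (by
    intro h0
    rw [h0, Nat.cast_zero] at hg
    exact not_isUnit_zero hg)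
  rw [← natCard_fixedPoints_zpowers_eq _ g] at hN
  exact hF.exists_fin_isColimit_cofan_of_natCard_fixedPoints_eq hg hN0 hN

/-- **Cyclic case in characteristic `0`** (the consumer form over `ℂ`): `g ∈ Aut_k Y` of finite
order, `Y` smooth over the algebraically closed field `k` of characteristic `0`; if exactly `N ≠ 0`
rational points of `Y` are fixed by `g`, every fixed-point scheme of `⟨g⟩` is the coproduct of `N`
copies of `Spec k`.  For `k = ℂ`, `Y` smooth projective of `Kum⁴`-type, `g = δ ∈ Γ(Y) ∖ 1` and
`N = 125` this is the conclusion of `Hyperkaehler.HassettTschinkel2013_Oguiso2020_fixedPointScheme_translation_kum4Type`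
from the COUNT of the `δ`-fixed `ℂ`-points alone.
[cite: ConradGabberPrasad2015, Prop. A.8.10(1)–(2)] [cite: GortzWedhorn2020, Cor. 3.36 and Prop. 5.20] -/
theorem exists_fin_isColimit_cofan_of_isOfFinOrder [CharZero K] [Smooth Y.hom] (g : Aut Y)
    (hg : IsOfFinOrder g) {N : ℕ} (hN0 : N ≠ 0)
    (hN : Nat.card {y : 𝟙_ (Over (Spec (CommRingCat.of K))) ⟶ Y // y ≫ g.hom = y} = N)
    ⦃F : Over (Spec (CommRingCat.of K))⦄ (j : F ⟶ Y)
    (hF : IsFixedPointScheme (Subgroup.zpowers g).subtype j) :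
    ∃ x : Fin N → (𝟙_ (Over (Spec (CommRingCat.of K))) ⟶ F),
      Function.Injective x ∧ Nonempty (IsColimit (Cofan.mk F x)) := by
  refine exists_fin_isColimit_cofan_of_natCard_fixedBy_eq g ?_ hN0 hN j hF
  rw [Nat.card_zpowers]
  exact (Nat.cast_ne_zero.mpr hg.orderOf_pos.ne').isUnit

end Literature.AlgebraicGeometry.GroupActions

end
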